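import Summits.QuantumFields.YangMills.Theorems.UnitScaleTiltProp7FramedCovLaplacian
import Summits.QuantumFields.YangMills.Theorems.UnitScaleTiltProp7PinnedSupOfGradient
import Summits.QuantumFields.YangMills.Theorems.UnitScaleTiltProp7InterpErrorPinAbstract
import Literature.MathematicalPhysics.QuantumFieldTheory.Balaban1983to89.MatrixNorms
import Literature.Barriers.QuantumFields.UnitaryHaarSmallBall
import HarnessLib

/-!
# Route `UnitScaleTilt`, crux K1 «MinimiserStabilityRegPr» (stmt-QuantumFields-19200), route-R E′ path (α′), (E1-b) covariant, row (hK₂-cov) — FILE F3a-cov «COV-PIN-CHARGE»: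
# THE PIN CHARGE OF A COVARIANTLY HARMONIC MATRIX FIELD, IN A LOCAL FRAME — framing letters (`‖v‖ = ‖V‖`, `Δ_h v = 0` off the pin, the flat Laplacian of the framed field is
# the frame junk with a FRAME-FREE bound), real-component extraction, and ★★★ the charge row `‖(Δ_UV)(y)‖ ≤ 2N²·[B·√#S·√(Σ_S‖V‖²) + Σ_{S′∖y}Φ] + Φ(y)` over px7 g3's abstract (Q)

Cell `ym3-torus`, width seat `ym3-torus-px11` (gen 3), LEAD of the (hK₂-cov) chain (routeR-w3 g6 WORDS (8)–(10)); LOCATE 19200 evidence #57 `LOCATE-HK2COV-px11g3.md` §1 row (Q).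
`--kind proof --supports stmt-QuantumFields-19200 --as helper`, count-neutral.  THEOREMS ONLY (0 `def`, 0 `sorry`).  YM₃ on T³ is a ladder rung (R3) — not d = 4, not infinite
volume, not a mass gap, not the Clay problem; nothing here claims the stub, the crux or the gap.

THE POINT.  `V := Δ_Uφ_H` (matrix-valued, covariantly harmonic off the centres) has at a centre `y` the PIN CHARGE `q₀ := (Δ_UV)(y)`.  In px4 g3's ball frame `Fr`
(✓p672574, rows `τ₁` on the framed links and `τ₂` on their differences) the framed field `v := R(Fr⁻¹)V` has `‖v‖ = ‖V‖` pointwise, `Δ_h v = R(Fr⁻¹)Δ_UV = 0` off the pin, hence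
its FLAT Laplacian equals the frame junk, `‖Δ₁v(z)‖ ≤ Φ(z)` with the FRAME-FREE row of ✓ `Prop7FramedCovLaplacian` (first covariant differences of `V` times `τ₁`, `V` times
`τ₂ + τ₁²`).  Each real component `u = Re∕Im (v)_{jk}` is then a real site function with `|Δ₁u| ≤ Φ` off the pin, and px7 g3's abstract charge row ✓ `abs_laplace_at_centre_le_of_cutoff`
(`|Δu(y)| ≤ B·√#S·√Σ_S u² + Σ_{S′∖y}|Δu|`, any cutoff `χ` with `χ y = 1`) applies component by component; summing `2N²` components and un-framing gives the charge row.
Everything is stated for an ABSTRACT cutoff `χ` and ABSTRACT frame rows; the member instantiation (χ := ✓ `exists_scale_cutoff`, frame := ✓p672574, masses := (V-loc-cov)) is F4-cov.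

WHAT IS PROVED (ns `…Theorems.Prop7CovPinCharge`; torus `Site P i`, bi-contractive background `U` and frame `Fr`, `L²`-operator norm on `M_N(ℂ)`; η-short `Δ_U`).
* §1 framing letters: `norm_framed_eq`, `framedLink_bicontr`, `covLaplace_framed_eq_zero`, ★ `norm_laplace_one_framed_le` (`Δ_UV z = 0` + rows at `z`, `z−e_μ` ⇒
  `‖Δ₁v(z)‖ ≤ Σ_μ[2τ₁(‖D_UV(z,μ)‖ + ‖D_UV(z−e_μ,μ)‖ + 2τ₁(‖V(z+e_μ)‖ + ‖V z‖)) + (2τ₂+4τ₁²)‖V(z−e_μ)‖]`), `norm_covLaplace_le_laplace_framed_add` (at the pin).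
* §2 component letters: `abs_re_im_entry_le` (over lit ✓ `norm_entry_le_l2_opNorm`), `laplace_one_re_entry`∕`_im_entry`, `norm_le_sum_abs_re_add_abs_im`.
* §3 ★★★ `norm_covLaplace_centre_le_of_cutoff` — the charge row of the title (abstract `χ, S, S′`, abstract junk majorant `Φ` displayed as a hypothesis `∀ x ∈ S′, x ≠ y → ‖Δ₁v x‖ ≤ Φ x`).
HONEST SCOPE.  Bookkeeping over landed bricks; the `L¹` bound of `Σ_{S′}Φ` through (C1) and the member numbers are F3c∕F4-cov.  Nothing of Bałaban's is asserted.

References: T. Bałaban, CMP 99 (1985) 389–434 [Balaban1985BackgroundPropagators] ((3.3) p.390, (3.8) p.392, (3.28) p.395, (3.35) p.396); CMP 102 (1985) 277–309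
[Balaban1985Variational] (Prop. 7 p.299).
-/

set_option autoImplicit false

noncomputable section

open scoped BigOperators Matrix.Norms.L2Operator Matrix

namespace Summit.QuantumFields.YangMills.Theorems.Prop7CovPinCharge

open Literature.MathematicalPhysics.QuantumFieldTheory.Balaban1983to89
open LatticeFieldCalculus (laplace)
open B9Eq39Adjoint (R R_inv_R R_zero covD divB)
open B9Eq310Hermitian (norm_R_le)
open B9TorusCalculus (torusT torusT_apply torusT_symm_apply)
open Summit.QuantumFields.YangMills.Theorems.Prop7PinnedSupOfGradient (norm_R_eq)
open B9Thm310CommutatorDataOfPlaquettes (bicontr_mul bicontr_inv)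
open Summit.QuantumFields.YangMills.Theorems.Prop7FramedSecondDifference (R_inv_frame_covD norm_covD_sub_fdiff_le norm_mul_sub_one_le)
open Summit.QuantumFields.YangMills.Theorems.Prop7FramedCovLaplacian (R_inv_frame_covLaplace norm_covLaplace_sub_laplace_one_le_T)
open Summit.QuantumFields.YangMills.Theorems.Prop7InterpErrorPinAbstract (abs_laplace_at_centre_le_of_cutoff)

variable {P : Params} {i : ℕ} {N : ℕ}

/-! ## §1 Framing letters -/

section Framing

variable (U : Fin P.d → Site P i → (Matrix (Fin N) (Fin N) ℂ)ˣ) (Fr : Site P i → (Matrix (Fin N) (Fin N) ℂ)ˣ)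

/-- `‖R(Fr z)⁻¹(V z)‖ = ‖V z‖` for a bi-contractive frame (the adjoint transport is an isometry, ✓ `norm_R_eq`). [cite: Balaban1985BackgroundPropagators, (3.1) p.390] -/
theorem norm_framed_eq (hFr : ∀ z, ‖(Fr z : Matrix (Fin N) (Fin N) ℂ)‖ ≤ 1 ∧ ‖(((Fr z)⁻¹ : (Matrix (Fin N) (Fin N) ℂ)ˣ) : Matrix (Fin N) (Fin N) ℂ)‖ ≤ 1)
    (V : Site P i → Matrix (Fin N) (Fin N) ℂ) (z : Site P i) :
    ‖R (Fr z)⁻¹ (V z)‖ = ‖V z‖ := by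
  refine norm_R_eq (hFr z).2 ?_ (V z)
  rw [inv_inv]; exact (hFr z).1

/-- In a frame, `Δ_UV(z) = 0` implies `Δ_h v(z) = 0` for the framed field `v = R(Fr⁻¹)V` and framed links `h = Fr⁻¹·U·Fr(·+e_μ)` (✓ `R_inv_frame_covLaplace`).
[cite: Balaban1985BackgroundPropagators, (3.28) p.395] -/
theorem covLaplace_framed_eq_zero (V : Site P i → Matrix (Fin N) (Fin N) ℂ) (z : Site P i)
    (hz : divB (torusT P i) U (fun μ => covD (torusT P i) U μ V) z = 0) :
    divB (torusT P i) (fun κ w => (Fr w)⁻¹ * U κ w * Fr (torusT P i κ w))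
      (fun μ => covD (torusT P i) (fun κ w => (Fr w)⁻¹ * U κ w * Fr (torusT P i κ w)) μ (fun w => R (Fr w)⁻¹ (V w))) z = 0 := by
  rw [← R_inv_frame_covLaplace (torusT P i) U Fr V z, hz, R_zero]

/-- The framed links are bi-contractive when `U` and `Fr` are (✓ `bicontr_mul`, ✓ `bicontr_inv`). [folklore] -/
theorem framedLink_bicontr
    (hU : ∀ (κ : Fin P.d) (y : Site P i), ‖(U κ y : Matrix (Fin N) (Fin N) ℂ)‖ ≤ 1 ∧ ‖(((U κ y)⁻¹ : (Matrix (Fin N) (Fin N) ℂ)ˣ) : Matrix (Fin N) (Fin N) ℂ)‖ ≤ 1)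
    (hFr : ∀ z, ‖(Fr z : Matrix (Fin N) (Fin N) ℂ)‖ ≤ 1 ∧ ‖(((Fr z)⁻¹ : (Matrix (Fin N) (Fin N) ℂ)ˣ) : Matrix (Fin N) (Fin N) ℂ)‖ ≤ 1)
    (κ : Fin P.d) (y : Site P i) :
    ‖(((Fr y)⁻¹ * U κ y * Fr (torusT P i κ y) : (Matrix (Fin N) (Fin N) ℂ)ˣ) : Matrix (Fin N) (Fin N) ℂ)‖ ≤ 1 ∧
      ‖((((Fr y)⁻¹ * U κ y * Fr (torusT P i κ y))⁻¹ : (Matrix (Fin N) (Fin N) ℂ)ˣ) : Matrix (Fin N) (Fin N) ℂ)‖ ≤ 1 :=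
  bicontr_mul (bicontr_mul (bicontr_inv (hFr y)) (hU κ y)) (hFr _)

/-- First differences of the framed field cost one covariant difference of `V` plus `2τ₁‖V‖`:
`‖v(z+e_μ) − v(z)‖ ≤ ‖(D_UV)(z,μ)‖ + 2‖h_μ z − 1‖·‖V(z+e_μ)‖` (✓ `norm_covD_sub_fdiff_le` + ✓ `R_inv_frame_covD` + isometry). [cite: Balaban1985BackgroundPropagators, (3.3) p.390, (3.35) p.396] -/
theorem norm_framed_fdiff_le
    (hU : ∀ (κ : Fin P.d) (y : Site P i), ‖(U κ y : Matrix (Fin N) (Fin N) ℂ)‖ ≤ 1 ∧ ‖(((U κ y)⁻¹ : (Matrix (Fin N) (Fin N) ℂ)ˣ) : Matrix (Fin N) (Fin N) ℂ)‖ ≤ 1)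
    (hFr : ∀ z, ‖(Fr z : Matrix (Fin N) (Fin N) ℂ)‖ ≤ 1 ∧ ‖(((Fr z)⁻¹ : (Matrix (Fin N) (Fin N) ℂ)ˣ) : Matrix (Fin N) (Fin N) ℂ)‖ ≤ 1)
    (V : Site P i → Matrix (Fin N) (Fin N) ℂ) (μ : Fin P.d) (z : Site P i) :
    ‖R (Fr (z.shift μ))⁻¹ (V (z.shift μ)) - R (Fr z)⁻¹ (V z)‖
      ≤ ‖covD (torusT P i) U μ V z‖
        + 2 * ‖(((Fr z)⁻¹ * U μ z * Fr (torusT P i μ z) : (Matrix (Fin N) (Fin N) ℂ)ˣ) : Matrix (Fin N) (Fin N) ℂ) - 1‖ * ‖V (z.shift μ)‖ := by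
  set h : Fin P.d → Site P i → (Matrix (Fin N) (Fin N) ℂ)ˣ := fun κ w => (Fr w)⁻¹ * U κ w * Fr (torusT P i κ w) with hh
  set v : Site P i → Matrix (Fin N) (Fin N) ℂ := fun w => R (Fr w)⁻¹ (V w) with hv
  have hcov : covD (torusT P i) h μ v z = R (Fr z)⁻¹ (covD (torusT P i) U μ V z) := (R_inv_frame_covD (torusT P i) U Fr V μ z).symm
  have hd := norm_covD_sub_fdiff_le (torusT P i) h v μ z (framedLink_bicontr U Fr hU hFr μ z).2
  rw [hcov, torusT_apply] at hd
  have hiso : ‖R (Fr z)⁻¹ (covD (torusT P i) U μ V z)‖ = ‖covD (torusT P i) U μ V z‖ :=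
    norm_R_eq (hFr z).2 (by rw [inv_inv]; exact (hFr z).1) _
  have hvz : ‖v (z.shift μ)‖ = ‖V (z.shift μ)‖ := norm_framed_eq Fr hFr V (z.shift μ)
  set X := R (Fr z)⁻¹ (covD (torusT P i) U μ V z) with hX
  have htri : ‖v (z.shift μ) - v z‖ ≤ ‖X‖ + ‖X - (v (z.shift μ) - v z)‖ := by
    calc ‖v (z.shift μ) - v z‖ = ‖X - (X - (v (z.shift μ) - v z))‖ := by rw [sub_sub_cancel]
      _ ≤ ‖X‖ + ‖X - (v (z.shift μ) - v z)‖ := norm_sub_le _ _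
  have hgoal : ‖v (z.shift μ) - v z‖ ≤ ‖covD (torusT P i) U μ V z‖ + 2 * ‖((h μ z : (Matrix (Fin N) (Fin N) ℂ)ˣ) : Matrix (Fin N) (Fin N) ℂ) - 1‖ * ‖V (z.shift μ)‖ := by
    rw [← hiso, ← hvz]; linarith
  simpa only [hv, hh] using hgoal

/-- ★ **THE FLAT LAPLACIAN OF THE FRAMED FIELD IS THE FRAME JUNK, WITH A FRAME-FREE BOUND**: if `Δ_UV(z) = 0` and the framed links obey `‖h_μ z − 1‖ ≤ τ₁`,
`‖h_μ(z−e_μ) − 1‖ ≤ τ₁`, `‖h_μ z − h_μ(z−e_μ)‖ ≤ τ₂` (all `μ`), then for `v = R(Fr⁻¹)V`: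
`‖Δ₁v(z)‖ ≤ Σ_μ [2τ₁·(‖D_UV(z,μ)‖ + ‖D_UV(z−e_μ,μ)‖ + 2τ₁(‖V(z+e_μ)‖ + ‖V z‖)) + (2τ₂ + 4τ₁²)·‖V(z−e_μ)‖]` — no frame on the right.
[cite: Balaban1985BackgroundPropagators, (3.8) p.392, (3.28) p.395, (3.35) p.396] -/
theorem norm_laplace_one_framed_le
    (hU : ∀ (κ : Fin P.d) (y : Site P i), ‖(U κ y : Matrix (Fin N) (Fin N) ℂ)‖ ≤ 1 ∧ ‖(((U κ y)⁻¹ : (Matrix (Fin N) (Fin N) ℂ)ˣ) : Matrix (Fin N) (Fin N) ℂ)‖ ≤ 1)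
    (hFr : ∀ z, ‖(Fr z : Matrix (Fin N) (Fin N) ℂ)‖ ≤ 1 ∧ ‖(((Fr z)⁻¹ : (Matrix (Fin N) (Fin N) ℂ)ˣ) : Matrix (Fin N) (Fin N) ℂ)‖ ≤ 1)
    (V : Site P i → Matrix (Fin N) (Fin N) ℂ) (z : Site P i) (hz : divB (torusT P i) U (fun μ => covD (torusT P i) U μ V) z = 0) {τ₁ τ₂ : ℝ}
    (h1 : ∀ μ, ‖(((Fr z)⁻¹ * U μ z * Fr (torusT P i μ z) : (Matrix (Fin N) (Fin N) ℂ)ˣ) : Matrix (Fin N) (Fin N) ℂ) - 1‖ ≤ τ₁)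
    (h1' : ∀ μ, ‖(((Fr (z.unshift μ))⁻¹ * U μ (z.unshift μ) * Fr (torusT P i μ (z.unshift μ)) : (Matrix (Fin N) (Fin N) ℂ)ˣ) : Matrix (Fin N) (Fin N) ℂ) - 1‖ ≤ τ₁)
    (h2 : ∀ μ, ‖(((Fr z)⁻¹ * U μ z * Fr (torusT P i μ z) : (Matrix (Fin N) (Fin N) ℂ)ˣ) : Matrix (Fin N) (Fin N) ℂ)
        - (((Fr (z.unshift μ))⁻¹ * U μ (z.unshift μ) * Fr (torusT P i μ (z.unshift μ)) : (Matrix (Fin N) (Fin N) ℂ)ˣ) : Matrix (Fin N) (Fin N) ℂ)‖ ≤ τ₂) :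
    ‖laplace 1 (fun w => R (Fr w)⁻¹ (V w)) z‖
      ≤ ∑ μ : Fin P.d, (2 * τ₁ * (‖covD (torusT P i) U μ V z‖ + ‖covD (torusT P i) U μ V (z.unshift μ)‖ + 2 * τ₁ * (‖V (z.shift μ)‖ + ‖V z‖))
          + (2 * τ₂ + 4 * τ₁ ^ 2) * ‖V (z.unshift μ)‖) := by
  set h : Fin P.d → Site P i → (Matrix (Fin N) (Fin N) ℂ)ˣ := fun κ w => (Fr w)⁻¹ * U κ w * Fr (torusT P i κ w) with hh
  set v : Site P i → Matrix (Fin N) (Fin N) ℂ := fun w => R (Fr w)⁻¹ (V w) with hv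
  have hτ₁ : 0 ≤ τ₁ := (norm_nonneg _).trans (h1 ⟨0, P.hd⟩)
  have hbic := framedLink_bicontr U Fr hU hFr
  -- `Δ_h v z = 0`
  have hzero : divB (torusT P i) h (fun μ => covD (torusT P i) h μ v) z = 0 := covLaplace_framed_eq_zero U Fr V z hz
  -- the comparison row
  have hcmp := norm_covLaplace_sub_laplace_one_le_T h hbic v z (τ₁ := τ₁) (τ₂ := τ₂) h1 h1' h2
  rw [hzero, zero_sub, norm_neg] at hcmp
  refine hcmp.trans (Finset.sum_le_sum fun μ _ => ?_)
  -- `‖v(z+e_μ) − v(z−e_μ)‖ ≤ (‖D_UV z‖ + 2τ₁‖V(z+e_μ)‖) + (‖D_UV(z−e_μ)‖ + 2τ₁‖V z‖)`, `‖v(z−e_μ)‖ = ‖V(z−e_μ)‖`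
  have hA := norm_framed_fdiff_le U Fr hU hFr V μ z
  have hB := norm_framed_fdiff_le U Fr hU hFr V μ (z.unshift μ)
  simp only [Site.shift_unshift] at hB
  have hA' : ‖v (z.shift μ) - v z‖ ≤ ‖covD (torusT P i) U μ V z‖ + 2 * τ₁ * ‖V (z.shift μ)‖ := by
    refine hA.trans (add_le_add le_rfl (mul_le_mul_of_nonneg_right (mul_le_mul_of_nonneg_left (h1 μ) (by norm_num)) (norm_nonneg _)))
  have hB' : ‖v z - v (z.unshift μ)‖ ≤ ‖covD (torusT P i) U μ V (z.unshift μ)‖ + 2 * τ₁ * ‖V z‖ := by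
    refine hB.trans (add_le_add le_rfl (mul_le_mul_of_nonneg_right (mul_le_mul_of_nonneg_left ?_ (by norm_num)) (norm_nonneg _)))
    simpa only [torusT_apply, Site.unshift_shift] using h1' μ
  have hdiff : ‖v (z.shift μ) - v (z.unshift μ)‖
      ≤ ‖covD (torusT P i) U μ V z‖ + ‖covD (torusT P i) U μ V (z.unshift μ)‖ + 2 * τ₁ * (‖V (z.shift μ)‖ + ‖V z‖) := by
    calc ‖v (z.shift μ) - v (z.unshift μ)‖ = ‖(v (z.shift μ) - v z) + (v z - v (z.unshift μ))‖ := by rw [sub_add_sub_cancel]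
      _ ≤ ‖v (z.shift μ) - v z‖ + ‖v z - v (z.unshift μ)‖ := norm_add_le _ _
      _ ≤ _ := by linarith
  have hvu : ‖v (z.unshift μ)‖ = ‖V (z.unshift μ)‖ := norm_framed_eq Fr hFr V _
  rw [hvu]
  have hc : 0 ≤ 2 * τ₂ + 4 * τ₁ ^ 2 := by
    have : 0 ≤ τ₂ := (norm_nonneg _).trans (h2 ⟨0, P.hd⟩)
    positivity
  gcongr

/-- **AT THE PIN**: with `Δ_h v(y) = R(Fr y)⁻¹(Δ_UV)(y)` and the same rows at `y`, `‖(Δ_UV)(y)‖ ≤ ‖Δ₁v(y)‖ + Σ_μ[2τ₁(…) + (2τ₂+4τ₁²)‖V(y−e_μ)‖]`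
(isometry + the comparison row). [cite: Balaban1985BackgroundPropagators, (3.8) p.392, (3.35) p.396] -/
theorem norm_covLaplace_le_laplace_framed_add
    (hU : ∀ (κ : Fin P.d) (y : Site P i), ‖(U κ y : Matrix (Fin N) (Fin N) ℂ)‖ ≤ 1 ∧ ‖(((U κ y)⁻¹ : (Matrix (Fin N) (Fin N) ℂ)ˣ) : Matrix (Fin N) (Fin N) ℂ)‖ ≤ 1)
    (hFr : ∀ z, ‖(Fr z : Matrix (Fin N) (Fin N) ℂ)‖ ≤ 1 ∧ ‖(((Fr z)⁻¹ : (Matrix (Fin N) (Fin N) ℂ)ˣ) : Matrix (Fin N) (Fin N) ℂ)‖ ≤ 1)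
    (V : Site P i → Matrix (Fin N) (Fin N) ℂ) (y : Site P i) {τ₁ τ₂ : ℝ}
    (h1 : ∀ μ, ‖(((Fr y)⁻¹ * U μ y * Fr (torusT P i μ y) : (Matrix (Fin N) (Fin N) ℂ)ˣ) : Matrix (Fin N) (Fin N) ℂ) - 1‖ ≤ τ₁)
    (h1' : ∀ μ, ‖(((Fr (y.unshift μ))⁻¹ * U μ (y.unshift μ) * Fr (torusT P i μ (y.unshift μ)) : (Matrix (Fin N) (Fin N) ℂ)ˣ) : Matrix (Fin N) (Fin N) ℂ) - 1‖ ≤ τ₁)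
    (h2 : ∀ μ, ‖(((Fr y)⁻¹ * U μ y * Fr (torusT P i μ y) : (Matrix (Fin N) (Fin N) ℂ)ˣ) : Matrix (Fin N) (Fin N) ℂ)
        - (((Fr (y.unshift μ))⁻¹ * U μ (y.unshift μ) * Fr (torusT P i μ (y.unshift μ)) : (Matrix (Fin N) (Fin N) ℂ)ˣ) : Matrix (Fin N) (Fin N) ℂ)‖ ≤ τ₂) :
    ‖divB (torusT P i) U (fun μ => covD (torusT P i) U μ V) y‖
      ≤ ‖laplace 1 (fun w => R (Fr w)⁻¹ (V w)) y‖
        + ∑ μ : Fin P.d, (2 * τ₁ * (‖covD (torusT P i) U μ V y‖ + ‖covD (torusT P i) U μ V (y.unshift μ)‖ + 2 * τ₁ * (‖V (y.shift μ)‖ + ‖V y‖))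
          + (2 * τ₂ + 4 * τ₁ ^ 2) * ‖V (y.unshift μ)‖) := by
  set h : Fin P.d → Site P i → (Matrix (Fin N) (Fin N) ℂ)ˣ := fun κ w => (Fr w)⁻¹ * U κ w * Fr (torusT P i κ w) with hh
  set v : Site P i → Matrix (Fin N) (Fin N) ℂ := fun w => R (Fr w)⁻¹ (V w) with hv
  have hτ₁ : 0 ≤ τ₁ := (norm_nonneg _).trans (h1 ⟨0, P.hd⟩)
  have hbic := framedLink_bicontr U Fr hU hFr
  have hframe : R (Fr y)⁻¹ (divB (torusT P i) U (fun μ => covD (torusT P i) U μ V) y) = divB (torusT P i) h (fun μ => covD (torusT P i) h μ v) y :=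
    R_inv_frame_covLaplace (torusT P i) U Fr V y
  have hiso : ‖divB (torusT P i) U (fun μ => covD (torusT P i) U μ V) y‖ = ‖divB (torusT P i) h (fun μ => covD (torusT P i) h μ v) y‖ := by
    rw [← hframe]; exact (norm_R_eq (hFr y).2 (by rw [inv_inv]; exact (hFr y).1) _).symm
  have hcmp := norm_covLaplace_sub_laplace_one_le_T h hbic v y (τ₁ := τ₁) (τ₂ := τ₂) h1 h1' h2
  rw [hiso]
  have htri : ‖divB (torusT P i) h (fun μ => covD (torusT P i) h μ v) y‖
      ≤ ‖laplace 1 v y‖ + ‖divB (torusT P i) h (fun μ => covD (torusT P i) h μ v) y - laplace 1 v y‖ := by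
    calc _ = ‖laplace 1 v y + (divB (torusT P i) h (fun μ => covD (torusT P i) h μ v) y - laplace 1 v y)‖ := by rw [add_sub_cancel]
      _ ≤ _ := norm_add_le _ _
  refine htri.trans (add_le_add le_rfl (hcmp.trans (Finset.sum_le_sum fun μ _ => ?_)))
  have hA := norm_framed_fdiff_le U Fr hU hFr V μ y
  have hB := norm_framed_fdiff_le U Fr hU hFr V μ (y.unshift μ)
  simp only [Site.shift_unshift] at hB
  have hA' : ‖v (y.shift μ) - v y‖ ≤ ‖covD (torusT P i) U μ V y‖ + 2 * τ₁ * ‖V (y.shift μ)‖ := by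
    refine hA.trans (add_le_add le_rfl (mul_le_mul_of_nonneg_right (mul_le_mul_of_nonneg_left (h1 μ) (by norm_num)) (norm_nonneg _)))
  have hB' : ‖v y - v (y.unshift μ)‖ ≤ ‖covD (torusT P i) U μ V (y.unshift μ)‖ + 2 * τ₁ * ‖V y‖ := by
    refine hB.trans (add_le_add le_rfl (mul_le_mul_of_nonneg_right (mul_le_mul_of_nonneg_left ?_ (by norm_num)) (norm_nonneg _)))
    simpa only [torusT_apply, Site.unshift_shift] using h1' μ
  have hdiff : ‖v (y.shift μ) - v (y.unshift μ)‖
      ≤ ‖covD (torusT P i) U μ V y‖ + ‖covD (torusT P i) U μ V (y.unshift μ)‖ + 2 * τ₁ * (‖V (y.shift μ)‖ + ‖V y‖) := by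
    calc ‖v (y.shift μ) - v (y.unshift μ)‖ = ‖(v (y.shift μ) - v y) + (v y - v (y.unshift μ))‖ := by rw [sub_add_sub_cancel]
      _ ≤ ‖v (y.shift μ) - v y‖ + ‖v y - v (y.unshift μ)‖ := norm_add_le _ _
      _ ≤ _ := by linarith
  have hvu : ‖v (y.unshift μ)‖ = ‖V (y.unshift μ)‖ := norm_framed_eq Fr hFr V _
  rw [hvu]
  have hc : 0 ≤ 2 * τ₂ + 4 * τ₁ ^ 2 := by
    have : 0 ≤ τ₂ := (norm_nonneg _).trans (h2 ⟨0, P.hd⟩)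
    positivity
  gcongr

end Framing

/-! ## §2 Real-component letters (`L²`-operator norm on `M_N(ℂ)`) -/

section Components

/-- `|Re X_jk| ≤ ‖X‖`, `|Im X_jk| ≤ ‖X‖`. [folklore] -/
theorem abs_re_im_entry_le (X : Matrix (Fin N) (Fin N) ℂ) (j k : Fin N) : |(X j k).re| ≤ ‖X‖ ∧ |(X j k).im| ≤ ‖X‖ :=
  ⟨(Complex.abs_re_le_norm _).trans (Literature.Barriers.QuantumFields.norm_entry_le_l2_opNorm X j k), (Complex.abs_im_le_norm _).trans (Literature.Barriers.QuantumFields.norm_entry_le_l2_opNorm X j k)⟩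

/-- The flat Laplacian commutes with taking the real part of an entry. [folklore] -/
theorem laplace_one_re_entry (v : Site P i → Matrix (Fin N) (Fin N) ℂ) (z : Site P i) (j k : Fin N) :
    laplace 1 (fun w => ((v w) j k).re) z = ((laplace 1 v z) j k).re := by
  simp only [laplace, one_pow, one_smul, Matrix.sum_apply, Matrix.sub_apply, Matrix.add_apply, Complex.re_sum, Complex.sub_re, Complex.add_re]

/-- The flat Laplacian commutes with taking the imaginary part of an entry. [folklore] -/
theorem laplace_one_im_entry (v : Site P i → Matrix (Fin N) (Fin N) ℂ) (z : Site P i) (j k : Fin N) :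
    laplace 1 (fun w => ((v w) j k).im) z = ((laplace 1 v z) j k).im := by
  simp only [laplace, one_pow, one_smul, Matrix.sum_apply, Matrix.sub_apply, Matrix.add_apply, Complex.im_sum, Complex.sub_im, Complex.add_im]

/-- `Σ_i a_i² ≤ (Σ_i a_i)²` for nonnegative reals. [folklore] -/
theorem sum_sq_le_sq_sum {ι : Type*} (s : Finset ι) (a : ι → ℝ) (ha : ∀ x ∈ s, 0 ≤ a x) :
    ∑ x ∈ s, a x ^ 2 ≤ (∑ x ∈ s, a x) ^ 2 := by
  rw [sq, Finset.sum_mul]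
  refine Finset.sum_le_sum fun x hx => ?_
  rw [sq]
  exact mul_le_mul_of_nonneg_left (Finset.single_le_sum ha hx) (ha x hx)

/-- **RECONSTRUCTION**: `‖X‖ ≤ Σ_j Σ_k (|Re X_jk| + |Im X_jk|)` (`‖X‖² ≤ Σ‖X_jk‖²` lit ✓ `MatrixNorms.opNorm_sq_le_sum_norm_sq`, `Σa² ≤ (Σa)²`, `‖z‖ ≤ |Re z| + |Im z|`). [folklore] -/
theorem norm_le_sum_abs_re_add_abs_im (X : Matrix (Fin N) (Fin N) ℂ) :
    ‖X‖ ≤ ∑ j : Fin N, ∑ k : Fin N, (|(X j k).re| + |(X j k).im|) := by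
  classical
  have h1 : ‖X‖ ^ 2 ≤ ∑ j : Fin N, ∑ k : Fin N, ‖X j k‖ ^ 2 := MatrixNorms.opNorm_sq_le_sum_norm_sq X
  -- flatten the double sum over `Fin N × Fin N`
  have hflat : ∀ f : Fin N → Fin N → ℝ, ∑ j : Fin N, ∑ k : Fin N, f j k = ∑ p : Fin N × Fin N, f p.1 p.2 :=
    fun f => (Fintype.sum_prod_type (fun p : Fin N × Fin N => f p.1 p.2)).symm
  have h2 : ∑ j : Fin N, ∑ k : Fin N, ‖X j k‖ ^ 2 ≤ (∑ j : Fin N, ∑ k : Fin N, ‖X j k‖) ^ 2 := by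
    rw [hflat (fun j k => ‖X j k‖ ^ 2), hflat (fun j k => ‖X j k‖)]
    exact sum_sq_le_sq_sum _ _ fun _ _ => norm_nonneg _
  have h3 : ‖X‖ ≤ ∑ j : Fin N, ∑ k : Fin N, ‖X j k‖ :=
    (pow_le_pow_iff_left₀ (norm_nonneg _) (Finset.sum_nonneg fun _ _ => Finset.sum_nonneg fun _ _ => norm_nonneg _) two_ne_zero).1
      (h1.trans h2)
  exact h3.trans (Finset.sum_le_sum fun j _ => Finset.sum_le_sum fun k _ => Complex.norm_le_abs_re_add_abs_im _)

end Components

/-! ## §3 ★★★ The charge row over px7's abstract (Q) -/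

section Charge

variable (U : Fin P.d → Site P i → (Matrix (Fin N) (Fin N) ℂ)ˣ) (Fr : Site P i → (Matrix (Fin N) (Fin N) ℂ)ˣ)

/-- ★★★ **THE PIN CHARGE OF A COVARIANTLY HARMONIC MATRIX FIELD** (abstract cutoff and frame): `U`, `Fr` bi-contractive; the framed links obey the `τ₁ τ₂` rows at the pin `y`
and at `y − e_μ`; a real cutoff `χ` with `χ y = 1`, `|χ| ≤ 1`, `|Δ₁χ| ≤ B` everywhere, `Δ₁χ = 0` off `S`, `χ = 0` off `S′`; and a junk majorant `Φ` of the FLAT Laplacian of the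
framed field `v = R(Fr⁻¹)V` on `S′∖{y}` (✓ `norm_laplace_one_framed_le` supplies it where `Δ_UV = 0`).  THEN
`‖(Δ_UV)(y)‖ ≤ 2N²·(B·√#S·√(Σ_{x∈S}‖V x‖²) + Σ_{x∈S′∖y} Φ x) + Σ_μ[2τ₁(‖D_UV(y,μ)‖ + ‖D_UV(y−e_μ,μ)‖ + 2τ₁(‖V(y+e_μ)‖ + ‖V y‖)) + (2τ₂+4τ₁²)‖V(y−e_μ)‖]`
(px7 g3's ✓ `abs_laplace_at_centre_le_of_cutoff` on each of the `2N²` real components of `v`, `|u| ≤ ‖v‖ = ‖V‖`, reconstruction, and the pin comparison).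
[cite: Balaban1985Variational, Prop. 7 p.299; Balaban1985BackgroundPropagators, (3.8) p.392, (3.35) p.396] -/
theorem norm_covLaplace_centre_le_of_cutoff
    (hU : ∀ (κ : Fin P.d) (y : Site P i), ‖(U κ y : Matrix (Fin N) (Fin N) ℂ)‖ ≤ 1 ∧ ‖(((U κ y)⁻¹ : (Matrix (Fin N) (Fin N) ℂ)ˣ) : Matrix (Fin N) (Fin N) ℂ)‖ ≤ 1)
    (hFr : ∀ z, ‖(Fr z : Matrix (Fin N) (Fin N) ℂ)‖ ≤ 1 ∧ ‖(((Fr z)⁻¹ : (Matrix (Fin N) (Fin N) ℂ)ˣ) : Matrix (Fin N) (Fin N) ℂ)‖ ≤ 1)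
    (V : Site P i → Matrix (Fin N) (Fin N) ℂ) (y : Site P i) {τ₁ τ₂ : ℝ}
    (h1 : ∀ μ, ‖(((Fr y)⁻¹ * U μ y * Fr (torusT P i μ y) : (Matrix (Fin N) (Fin N) ℂ)ˣ) : Matrix (Fin N) (Fin N) ℂ) - 1‖ ≤ τ₁)
    (h1' : ∀ μ, ‖(((Fr (y.unshift μ))⁻¹ * U μ (y.unshift μ) * Fr (torusT P i μ (y.unshift μ)) : (Matrix (Fin N) (Fin N) ℂ)ˣ) : Matrix (Fin N) (Fin N) ℂ) - 1‖ ≤ τ₁)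
    (h2 : ∀ μ, ‖(((Fr y)⁻¹ * U μ y * Fr (torusT P i μ y) : (Matrix (Fin N) (Fin N) ℂ)ˣ) : Matrix (Fin N) (Fin N) ℂ)
        - (((Fr (y.unshift μ))⁻¹ * U μ (y.unshift μ) * Fr (torusT P i μ (y.unshift μ)) : (Matrix (Fin N) (Fin N) ℂ)ˣ) : Matrix (Fin N) (Fin N) ℂ)‖ ≤ τ₂)
    (χ : Site P i → ℝ) (hχy : χ y = 1) {B : ℝ} (hB : ∀ x, |laplace 1 χ x| ≤ B) (hχ1 : ∀ x, |χ x| ≤ 1)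
    (S : Finset (Site P i)) (hS : ∀ x ∉ S, laplace 1 χ x = 0) (S' : Finset (Site P i)) (hS' : ∀ x ∉ S', χ x = 0)
    (Φ : Site P i → ℝ) (hΦ : ∀ x ∈ S'.erase y, ‖laplace 1 (fun w => R (Fr w)⁻¹ (V w)) x‖ ≤ Φ x) :
    ‖divB (torusT P i) U (fun μ => covD (torusT P i) U μ V) y‖
      ≤ 2 * (N : ℝ) ^ 2 * (B * (Real.sqrt (S.card : ℝ) * Real.sqrt (∑ x ∈ S, ‖V x‖ ^ 2)) + ∑ x ∈ S'.erase y, Φ x)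
        + ∑ μ : Fin P.d, (2 * τ₁ * (‖covD (torusT P i) U μ V y‖ + ‖covD (torusT P i) U μ V (y.unshift μ)‖ + 2 * τ₁ * (‖V (y.shift μ)‖ + ‖V y‖))
          + (2 * τ₂ + 4 * τ₁ ^ 2) * ‖V (y.unshift μ)‖) := by
  classical
  set v : Site P i → Matrix (Fin N) (Fin N) ℂ := fun w => R (Fr w)⁻¹ (V w) with hv
  have hB0 : 0 ≤ B := (abs_nonneg _).trans (hB y)
  -- the bound for ONE real component `u` of `v`
  set Q : ℝ := B * (Real.sqrt (S.card : ℝ) * Real.sqrt (∑ x ∈ S, ‖V x‖ ^ 2)) + ∑ x ∈ S'.erase y, Φ x with hQ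
  have hcomp : ∀ u : Site P i → ℝ, (∀ x, |u x| ≤ ‖V x‖) → (∀ x ∈ S'.erase y, |laplace 1 u x| ≤ Φ x) → |laplace 1 u y| ≤ Q := by
    intro u hu hΔu
    have h := abs_laplace_at_centre_le_of_cutoff 1 y u χ hχy hB hχ1 S hS S' hS'
    refine h.trans (add_le_add (mul_le_mul_of_nonneg_left (mul_le_mul_of_nonneg_left
      (Real.sqrt_le_sqrt (Finset.sum_le_sum fun x _ => ?_)) (Real.sqrt_nonneg _)) hB0) (Finset.sum_le_sum hΔu))
    have hux := hu x
    have h0 : 0 ≤ ‖V x‖ := norm_nonneg _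
    rw [← sq_abs]
    exact pow_le_pow_left₀ (abs_nonneg _) hux 2
  -- the components: `|Re∕Im (v x)_jk| ≤ ‖v x‖ = ‖V x‖` and `|Δ₁ u| = |Re∕Im (Δ₁v)_jk| ≤ ‖Δ₁ v‖ ≤ Φ`
  have hvV : ∀ x, ‖v x‖ = ‖V x‖ := fun x => norm_framed_eq Fr hFr V x
  have hre : ∀ j k, |laplace 1 (fun w => ((v w) j k).re) y| ≤ Q := by
    intro j k
    refine hcomp _ (fun x => ((abs_re_im_entry_le (v x) j k).1).trans (hvV x).le) fun x hx => ?_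
    rw [laplace_one_re_entry]
    exact ((abs_re_im_entry_le _ j k).1).trans (hΦ x hx)
  have him : ∀ j k, |laplace 1 (fun w => ((v w) j k).im) y| ≤ Q := by
    intro j k
    refine hcomp _ (fun x => ((abs_re_im_entry_le (v x) j k).2).trans (hvV x).le) fun x hx => ?_
    rw [laplace_one_im_entry]
    exact ((abs_re_im_entry_le _ j k).2).trans (hΦ x hx)
  -- reconstruction of `‖Δ₁v(y)‖`
  have hlap : ‖laplace 1 v y‖ ≤ 2 * (N : ℝ) ^ 2 * Q := by
    refine (norm_le_sum_abs_re_add_abs_im _).trans ?_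
    calc ∑ j : Fin N, ∑ k : Fin N, (|((laplace 1 v y) j k).re| + |((laplace 1 v y) j k).im|)
        ≤ ∑ _j : Fin N, ∑ _k : Fin N, (Q + Q) := Finset.sum_le_sum fun j _ => Finset.sum_le_sum fun k _ => by
          rw [← laplace_one_re_entry, ← laplace_one_im_entry]
          exact add_le_add (hre j k) (him j k)
      _ = 2 * (N : ℝ) ^ 2 * Q := by
          simp only [Finset.sum_const, Finset.card_univ, Fintype.card_fin, nsmul_eq_mul]; ring
  have hpin := norm_covLaplace_le_laplace_framed_add U Fr hU hFr V y (τ₁ := τ₁) (τ₂ := τ₂) h1 h1' h2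
  rw [hQ] at hlap
  linarith

end Charge

end Summit.QuantumFields.YangMills.Theorems.Prop7CovPinCharge

end
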